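import Summits.BirchSwinnertonDyer.Rank1Residual.Additive.GordCycLowerBoundClass
import Summits.BirchSwinnertonDyer.Rank1Residual.AdditivePotMult.RankOneHeegnerClass
import HarnessLib

/-!
# O7-ord ∩ X4♯(G-ord), rank ONE, `p ≥ 5`: `BSD(E,p)` from PUBLISHED theorems plus the typed
# Eisenstein half `CycLowerBoundAt` for `E` (rank-one form, Schneider rider explicit) and the Miller
# lower halves of its rank-zero Heegner twists (cell `b2b-bsdres`, team n1011, seat p01, OWNERS row T-O7)

HONEST FRAMING (cell `b2b-bsdres`, run/shared/lean/b2b/bsd-rank1-residual/, verbatim in every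
file): prove what is provable now; shrink each hard class to its core with data; no claim beyond
stated classes. Research routes; census output = EVIDENCE / conjecture items, never a Literature
fact; RESIDUAL-MAP marks change only by signed lines. §I O7 stays OPEN; X4♯(G-ord) stays
CONSTRUCTION-SHAPED; nothing is booked; no label changes. COVERAGE (stated first, referee 1
proviso): `p ≥ 5`, `E` non-CM, non-anomalous reduction over the (G)-fields (A175
`Delbourgo2002.mainTheorem`), `ρ̄_{E,p}` surjective, Manin datum `p ∤ c(D)` and `p ∤ ∏c_ℓ(E)`
(additive-p1's rank-one Kolyvagin route); `p = 3` is NOT covered here (A175's TODO; p16's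
`mainTheorem_three` in review). The same-`j` rank-zero twists enter in MILLER currency
(`Typed.MissingLowerBoundAt`), NOT through `CycLowerBoundAt`, because the tree has no lemma
transporting `TypeGOrd` along a `p`-adically-trivial quadratic twist (referee 1, ACK-1 T-O7 proviso (3)).
Theorems only; no definition, no named fact, no `_holds`.

What: `ClassX4Gord.bsdp_rankOne_of_cycLowerBound_of_lowerTwists` — for `(E,p) ∈ X4♯(G-ord)`,
`ord_{s=1} L(E,s) = 1`: **`BSD(E,p)` ⟸ [∀ `Dh` with Delbourgo's (B)-clauses: `Reg_p(Dh) ≠ 0` ∧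
`CycLowerBoundAt E p Dh`] ∧ [every rank-zero Heegner twist `E^{(d_K)}` (K imaginary quadratic with
the Heegner hypothesis for `N_E`) satisfies `Typed.MissingLowerBoundAt`]**, all other inputs
published: Delbourgo 2002 (A)+(B) (`hDel`), Gross–Zagier (`hGZ`), Kolyvagin (`hKo`, `hB`), GZK,
modularity (`hmod`, `hnf`), Friedberg–Hoffstein (`hFH`). Chain: `GordCycLowerBoundClass`
(`ClassX4Gord.missingLowerBoundAt_rankLeOne_of_cycLowerBound`) for the lower half of `E`, then
additive-p1's `AdditivePotMult.bsdp_of_bad_rankOne_of_lower_of_lowerTwists` (Kolyvagin's upper half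
in rank one relative to the twists' lower halves).

References: [Delbourgo2002] Thm. (A), (B) (p. 40); [Kolyvagin1990]; [GrossLMS1991] §1;
[Miller2011LMS] Def. 1.1.
-/

noncomputable section

open scoped Classical NumberField

open WeierstrassCurve NumberField Literature.NumberTheory.EllipticCurves
  Literature.NumberTheory.EllipticCurves.ModularForms
  Literature.NumberTheory.EllipticCurves.Rank1Residual
  Literature.NumberTheory.EllipticCurves.Rank1Residual.Typed
  Literature.NumberTheory.EllipticCurves.Delbourgo2002
  Literature.NumberTheory.Automorphic
  IsDedekindDomain

namespace Summit.BirchSwinnertonDyer.Rank1Residual.Additive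

variable {W : WeierstrassCurve ℚ} [W.IsElliptic] [W.IsGloballyMinimal] {p : ℕ} [hp : Fact p.Prime]

/-- **O7-ord ∩ X4♯(G-ord), RANK ONE, `p ≥ 5`: `BSD(E,p)` from published theorems, the typed Eisenstein
half for `E`, and the Miller lower halves of its rank-zero Heegner twists.** For `(E,p) ∈ X4♯(G-ord)`
(`W` globally minimal; `ClassX4 ∧ TypeGOrd`), `E` non-CM, non-anomalous over the (G)-fields, `p ≥ 5`,
`ρ̄_{E,p}` onto, `ord_{s=1} L(E,s) = 1`, a parametrisation datum `D` at level `N_E` with `p ∤ c(D)`,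
`p ∤ ∏c_ℓ(E)`: IF for every height datum with Delbourgo's (B)-clauses the regulator is non-degenerate
(rider, EVIDENCE binder) and `CycLowerBoundAt W p Dh` holds, AND every rank-zero Heegner twist
`Wd ≅ E^{(d_K)}` satisfies `MissingLowerBoundAt Wd p`, THEN `BSDp W p`.
[cite: Delbourgo2002, Theorem (A), (B) (p. 40)] [cite: GrossLMS1991, §1 Thm. (Kolyvagin)]
[cite: Miller2011LMS, Def. 1.1] -/
theorem ClassX4Gord.bsdp_rankOne_of_cycLowerBound_of_lowerTwists (hDel : Delbourgo2002.mainTheorem)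
    (hGZ : ∀ (N : ℕ) [NeZero N] (W : WeierstrassCurve ℚ) (K : Type) [Field K] [NumberField K],
      gross_zagier N W K)
    (hKo : ∀ (N : ℕ) [NeZero N] (W : WeierstrassCurve ℚ) (K : Type) [Field K] [NumberField K],
      kolyvagin N W K)
    (hB : ∀ (N : ℕ) [NeZero N] (W : WeierstrassCurve ℚ) (K : Type) [Field K] [NumberField K],
      Kolyvagin1990_padicValNat_card_sha_le N W K)
    (hGZK : rank_eq_analyticRank_of_analyticRank_le_one) (hmod : hasEntireLFunction_rat)
    (hnf : exists_isNewformOf) (hFH : friedbergHoffstein_exists_heegnerField_split_twist_ne_zero)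
    [NeZero (W.conductorNorm ℤ)]
    (hX : ClassX4Gord W p) (hp5 : 5 ≤ p) (hcm : ¬ W.HasCM) (hna : ReductionNonAnomalous W p)
    (hsurj : Surj W p) (hr : W.analyticRank = 1)
    (D : ModularParametrizationData W (W.conductorNorm ℤ)) (hc : ¬ (p : ℤ) ∣ D.c)
    (htam : ¬ p ∣ W.tamagawaProduct)
    (hlowE : ∀ Dh : PAdicHeightData W p, LeadingTermClauses W p Dh →
      SchneiderConjecture Dh ∧ CycLowerBoundAt W p Dh)
    (hlowTw : ∀ (K : Type) [Field K] [NumberField K] (Wd : WeierstrassCurve ℚ) [Wd.IsElliptic]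
      [Wd.IsGloballyMinimal], IsImaginaryQuadratic K →
      SatisfiesHeegnerHypothesis (W.conductorNorm ℤ) K →
      (∃ C : VariableChange ℚ, C • W.quadraticTwist (NumberField.discr K : ℚ) = Wd) →
      Wd.analyticRank = 0 → MissingLowerBoundAt Wd p) :
    BSDp W p :=
  AdditivePotMult.bsdp_of_bad_rankOne_of_lower_of_lowerTwists hGZ hKo hB hGZK hmod hnf hFH W p
    hX.1.2.1.1 hX.1.2.2 hsurj hp5 hr D hc htam
    (hX.missingLowerBoundAt_rankLeOne_of_cycLowerBound hDel hGZK hp5 hcm (by rw [hr]) hna hlowE)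
    hlowTw

end Summit.BirchSwinnertonDyer.Rank1Residual.Additive

end
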